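import Summits.QuantumFields.YangMills.Theorems.BalabanUVNodesN20BankedRecordPrice
import Literature.MathematicalPhysics.QuantumFieldTheory.Balaban1983to89.T4PrintedShapeBanking

/-!
# N20 (NE7b), ITEM (c) BY NAME FROM THE CELL `pub-balaban`: the road-[e] stock budget `Σ_{Y ∈ Old} x Y ≤ ρ̄e^{−κ₁}·V·(Λσ)^{K−j⋆+1}∕(1−Λσ)` for a stock LABELLED by pending
# well-formed genealogies of `T4PersistenceDictionary.Gen`, its per-component prices DISCHARGED by `T4BankedInduction.rawFactor_le_recordPrice` under ANY `Banking`, its records by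
# `Gen.mem_records`; and at the dictionary (`ε = PEv`) under `T4PrintedShapeBanking.exists_irThreshold`: the budget from the TYPED FLOW (2.5)∕(2.7)∕(2.9) + ONE infrared threshold —
# the hypothesis «(R1) the banking» of the N20 records face STRUCK BY NAME (what stays: the labelling = (a) + (b), the multiplicities and residual budgets = (ID), the flow = (B))

Cell `pub-ymgap`, YM-PLAN Track A (HUMAN RULING D-0062); seat `pub-ymgap-dag-n20-d` (R134 (a) N20 NE7b s3), gen 41 — inside director-ym №374 line (E) ∕ item (c); road [e] TOWER-FREE of
record (№377).  `--kind proof --supports stmt-QuantumFields-27366 --as helper` (K3⁸); COUNT-NEUTRAL; THEOREMS ONLY (0 `def`).  [LF-II] = [Balaban1989LargeFieldII]; [III] =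
[Balaban1988Convergent].  Companions BY NAME: `…N20BankedRecordPrice.sum_stock_le_twoRate_of_componentPrices` (gen 41, p775106), `…N20FinalLevelBankedBudget.
sum_integral_le_weightKP_mul_sum_of_fibreDom` (gen 40, p771116), and the `pub-balaban` T4 lineage: `T4PersistenceDictionary.{Gen, Gen.WF, Gen.reach, Gen.root, Gen.rootStep, Gen.events,
Gen.mem_records, PEv, dictW}`, `T4BankedInduction.{Banking, credits, lifeCost, rawFactor_le_recordPrice}`, `T4PrintedShapeBanking.{Consts, Consts.Valid, Consistent, cost, credit, Emarg,
reserve, extn, exists_irThreshold}`.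

WHY (READING NOTE of this generation, bus 13:33Z).  Gens 40–41 typed item (c) of road [e] on the YMDAG side against `B16Improved189FullBudget`'s `Step.Budget` model.  The cell
`pub-balaban` ALREADY carries the banked induction END TO END in the records currency on its (ID) GENEALOGY LEDGER: `T4PersistenceDictionary` types the three located lifetime rules
(birth «K ≤ n₀ − j + R_j» p. 385, renewal «K = R_{j+1}» p. 386, merger «K ≤ K₂ + n₁ + R_{j+1}» p. 387) as `Gen ε` (born ∕ renew ∕ merge) with «pending ⟹ window cover ⟹ span
condition ⟹ `Gen.mem_records`»; `T4BankedInduction` types print's four per-case pay inequalities as the binders of `structure Banking` and proves `banked_induction` (the slack KEPT)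
and, exponentiated, `rawFactor_le_recordPrice`: `e^{−credits}·e^{+lifeCost} ≤ ρ_root·e^{−κ₁W_root}·Π_{e ∈ events∖root}(e^{−κ₁W_e}·η_e)` with `ρ_b = e^{−(reserve b + E b)}`, `η_e = e^{−E e}`
— EXACTLY the per-component price `hx` of p775106 §5; `T4PrintedShapeBanking.exists_irThreshold` INHABITS `Banking` by print's cost ∕ credit shapes along ANY run of the typed (2.5) ∕
(2.7) ∕ (2.9) (`B14.IsRj`, `B14.FlowIneq27`, `B14FlowStep.FlowIneq29`) past ONE infrared threshold `x₀ ≤ log g_K⁻²`, uniformly in the cutoff.  THIS FILE is the junction BY NAME: (§1)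
for a stock `Old` whose candidates `Y` are LABELLED by admissible well-formed genealogies `G Y` pending at the cutoff (`K < reach`), rooted at the candidate's birth slot, with root birth
kind in `Bk j`, record `events ∖ root` inside the event universe `E j`, and activity `x Y ≤ e^{−credits(G Y)}·e^{+lifeCost(G Y)}` (THE LABELLING — `pub-balaban`'s (ID)-a∕b∕c + R3′,
our (a) junction NC-NE7b-α + (b): the removed component's fibre-ratio factor is below the raw factor of its genealogy; DISPLAYED), any `Banking` with banks `κ₁·W + E` gives p775106's
`hx` and `hrec`, hence the two-rate stock budget with `ρ_b = n_b·e^{−(reserve b + E b)}`, `η_e = n_e·e^{−E e}` (multiplicities `n` = the admissible-sequence entropy, (ID)); (§2) at the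
dictionary `ε = PEv`, `W = dictW R n₁`, costs ∕ credits ∕ margins ∕ reserves ∕ extensions = `T4PrintedShapeBanking`'s printed shapes, admissibility = `Consistent C K R`: the same
under the `Banking` those shapes inhabit, and — `exists_irThreshold` BY NAME — ONE `x₀` (constants only) such that along EVERY run obeying the typed flow with `x₀ ≤ log g_K⁻²` the
stock budget holds at EVERY cutoff `K` for every so-labelled stock; (§3) the socket: p771116's `sum_integral_le_weightKP_mul_sum_of_fibreDom` with its smallness `hw` DISCHARGED per
image by §1 — the bad class weighs `≤ (1 − e^{−S_K})` of the total, `S_K` the two-rate budget, from fibrewise letters (a), removal ∕ filing ∕ LABELLING data (b), multiplicities and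
residual budgets (ID), and a `Banking` ((B) via §2).  After this file «(R1) the per-record prices — the cell's BANKING» is no longer a displayed hypothesis of road [e]: its arithmetic is
`T4BankedInduction`, its pay side is `T4PrintedShapeBanking` from the typed flow; the wall that remains is named ONCE — the labelling.

WHAT IS PROVED (kernel; compositions BY NAME, zero `sorry`).
§1 `mem_records_of_labelling` (`Gen.mem_records` at the slot's birth step), `componentPrice_of_labelling` (`rawFactor_le_recordPrice` in p775106's `hx` shape), ★★★
   `sum_stock_le_twoRate_of_bankedGenealogies` (abstract `ε`, any `Banking`).
§2 ★★★ `sum_stock_le_twoRate_of_printedShapeBanking` (the dictionary, a `Banking` of the printed shapes as hypothesis), ★★★ `exists_irThreshold_stockBudget` (ONE infrared threshold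
   for every cutoff, run and labelled stock: `exists_irThreshold` ∘ §2).
§3 ★★★ `sum_integral_le_weightKP_mul_sum_of_bankedGenealogies` (p771116's socket with `hw` discharged by §1: `Σ_B ∫t ≤ (1 − e^{−S_K})·Σ ∫t`).

HONEST FRAMING.  [bookkeeping]: three compositions by name; no estimate.  DISPLAYED and NOT proved here: the fibrewise letters `hDom` ((a), junction NC-NE7b-α, UNRULED), the removal ∕
fibre ∕ filing data and THE LABELLING `hx : x Y ≤ e^{−credits(G Y)}·e^{+lifeCost(G Y)}` by consistent well-formed pending genealogies ((b) + `pub-balaban`'s (ID)-a∕b∕c + R3′ — GAPS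
G-ne7bp1g9-1 there; the SAME wall as (a), named once), the multiplicities `hcard` and residual budgets `hρbar`∕`hηbar` (entropy, (ID); cf. the REMARK on K-uniform event universes in
`T4RecordPriceSeam` §4), the cells `#Cell a ≤ V·Λ^a` (p774413 discharges it on the torus), the typed flow + infrared smallness ((B) ∕ BetaPertH through `Setup.Flow` — the node owners').
The identification of `T4PrintedShapeBanking.Consts` with print's `O(1)`'s is READING (ID).  NO inequality of Bałaban's is asserted; NE7 ∕ NE7b ∕ NE7c NOT PRINTED for `d = 4` ∕ NOT
proved; no `Provisos` inhabitant claimed; K3⁸ untouched; N20 NOT discharged; counts UNMOVED (typed 28∕28 · discharged 8∕27); one finite four-torus programme at fixed `ε` — NOT ℝ⁴, NOT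
OS, NOT a mass gap, NOT the Clay problem.  No `def`, no `instance`, no `notation`, no `sorry`; no decl below carries a cite tag.

v1.1 (APPEND-ONLY §4; every v1 declaration byte-identical): ★★★ `sum_integral_le_weightKP_mul_sum_of_genealogyFactors` — §3 with the activities INSTANTIATED `x Y := e^{−credits(G Y)}·
e^{+lifeCost(G Y)}` (each candidate carries its genealogy; the labelling clause `hx` and `hx0` vanish): the one analytic letter left reads `z s ≤ Π_{Y ∈ φ σ s} rawFactor(G Y)` — (a) on the ledger.
-/

noncomputable section

open MeasureTheory
open Finset
open scoped BigOperators

namespace YMDAG.UVSplit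

open Literature.MathematicalPhysics.QuantumFieldTheory.Balaban1983to89
open Literature.MathematicalPhysics.QuantumFieldTheory.Balaban1983to89.B15.BasicStep (fibreIntegral)
open T4PersistentHistoryCount (records)
open T4PersistenceDictionary (Gen PEv dictW)
open T4BankedInduction (Banking credits lifeCost rawFactor_le_recordPrice)
open T4PrintedShapeBanking (Consistent exists_irThreshold)

/-! ## §1 A stock labelled by pending genealogies: records and prices by name, the budget by p775106 -/

section Labelled

variable {X γ ε : Type*} [DecidableEq γ] [DecidableEq ε]

/-- **THE RECORD OF A LABELLED CANDIDATE IS A RECORD OF THE COUNT** (`T4PersistenceDictionary.Gen.mem_records` BY NAME): a well-formed genealogy pending at the cutoff (`K < reach`),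
rooted at the candidate's birth step `j`, with its non-root events inside the event universe `E j`, has `events ∖ root ∈ records W j K (E j) root` — the clause `hrec` of p775106's
`sum_stock_le_twoRate_of_componentPrices`. [bookkeeping] -/
theorem mem_records_of_labelling (W : ε → ℕ) {K j : ℕ} (E : Finset ε) {G : Gen ε} (hwf : G.WF W) (hpend : K < G.reach W) (hroot : G.rootStep = j)
    (hev : G.events.erase G.root ⊆ E) : G.events.erase G.root ∈ records W j K E G.root := by
  have h := Gen.mem_records hwf hpend hev
  rwa [hroot] at h

/-- **THE PRICE OF A LABELLED CANDIDATE** (`T4BankedInduction.rawFactor_le_recordPrice` BY NAME, in p775106's `hx` shape): under ANY `Banking` with banks `κ₁·W e + E e`, an admissible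
well-formed genealogy `G` with `x ≤ e^{−credits G}·e^{+lifeCost G}` prices the candidate at `x ≤ e^{−(reserve root + E root)}·e^{−κ₁W root}·Π_{e ∈ events∖root}(e^{−κ₁W e}·e^{−E e})`.
[bookkeeping] -/
theorem componentPrice_of_labelling {adm : Gen ε → Prop} {W : ε → ℕ} {cost : Gen ε → ℕ → ℝ} {credit Emg reserve : ε → ℝ} {ext : Gen ε → Gen ε → ε → ℝ} {κ₁ : ℝ}
    (B : Banking adm W cost credit (fun e => κ₁ * (W e : ℝ) + Emg e) reserve ext) {G : Gen ε} (hadm : adm G) (hwf : G.WF W) {x : ℝ}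
    (hx : x ≤ Real.exp (-credits credit G) * Real.exp (lifeCost W cost G)) :
    x ≤ Real.exp (-(reserve G.root + Emg G.root)) * Real.exp (-(κ₁ * (W G.root : ℝ))) *
      ∏ e ∈ G.events.erase G.root, (Real.exp (-(κ₁ * (W e : ℝ))) * Real.exp (-Emg e)) :=
  hx.trans (rawFactor_le_recordPrice B hadm hwf)

/-- ★★★ **THE ROAD-[e] STOCK BUDGET FOR A STOCK LABELLED BY PENDING GENEALOGIES, UNDER ANY BANKING** (p775106's `sum_stock_le_twoRate_of_componentPrices` with `kind Y := root (G Y)`,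
`rec Y := events (G Y) ∖ root`, `hrec` DISCHARGED by `Gen.mem_records`, `hx` DISCHARGED by `rawFactor_le_recordPrice`): candidates filed under birth slots (old: `< j⋆ ≤ K`; cells
`#Cell a ≤ V·Λ^a`), each LABELLED by an admissible well-formed genealogy pending at `K`, rooted at its birth step, root kind in `Bk j`, record inside `E j` (events on `(j, K]`), activity
below the genealogy's raw factor; at most `n_b·Π_{e∈Q} n_e` candidates per (slot, root kind, record); residual budgets `Σ_{b ∈ Bk j} n_b·e^{−(reserve b + E b)} ≤ ρ̄`,
`Σ_{e ∈ E j, step e = τ} n_e·e^{−E e} ≤ η̄`; rate `Λ·e^{η̄−κ₁} < 1` ⇒ `Σ_{Y ∈ Old} x Y ≤ ρ̄e^{−κ₁}·V·(Λσ)^{K − j⋆ + 1}∕(1 − Λσ)`, `σ = e^{η̄−κ₁}`. [bookkeeping] -/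
theorem sum_stock_le_twoRate_of_bankedGenealogies (Old : Finset X) (slot : X → (Σ _ : ℕ, γ)) (G : X → Gen ε) (x : X → ℝ)
    (Cell : ℕ → Finset γ) {V Λ : ℝ} (hV : 0 ≤ V) (hΛ : 0 ≤ Λ) (hcell : ∀ a, ((Cell a).card : ℝ) ≤ V * Λ ^ a)
    (W : ε → ℕ) (step : ε → ℕ) {K : ℕ} (E Bk : ℕ → Finset ε) (hE : ∀ j, ∀ e ∈ E j, step e ∈ Ioc j K) {κ₁ ρbar ηbar : ℝ} (hκ : 0 ≤ κ₁)
    {adm : Gen ε → Prop} {cost : Gen ε → ℕ → ℝ} {credit Emg reserve : ε → ℝ} {ext : Gen ε → Gen ε → ε → ℝ}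
    (B : Banking adm W cost credit (fun e => κ₁ * (W e : ℝ) + Emg e) reserve ext)
    (nB n : ε → ℝ) (hnB : ∀ j, ∀ b ∈ Bk j, 0 ≤ nB b) (hn : ∀ j, ∀ e ∈ E j, 0 ≤ n e)
    (hρbar : ∀ j, ∑ b ∈ Bk j, nB b * Real.exp (-(reserve b + Emg b)) ≤ ρbar)
    (hηbar : ∀ j, ∀ τ ∈ Ioc j K, ∑ e ∈ E j with step e = τ, n e * Real.exp (-Emg e) ≤ ηbar) (hr : Λ * Real.exp (ηbar - κ₁) < 1)
    {jstar : ℕ} (hj : jstar ≤ K) (hold : ∀ Y ∈ Old, (slot Y).1 < jstar) (hmem : ∀ Y ∈ Old, (slot Y).2 ∈ Cell (K - (slot Y).1))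
    (hadm : ∀ Y ∈ Old, adm (G Y)) (hwf : ∀ Y ∈ Old, (G Y).WF W) (hpend : ∀ Y ∈ Old, K < (G Y).reach W)
    (hroot : ∀ Y ∈ Old, (G Y).rootStep = (slot Y).1) (hkind : ∀ Y ∈ Old, (G Y).root ∈ Bk (slot Y).1)
    (hev : ∀ Y ∈ Old, (G Y).events.erase (G Y).root ⊆ E (slot Y).1)
    (hx : ∀ Y ∈ Old, x Y ≤ Real.exp (-credits credit (G Y)) * Real.exp (lifeCost W cost (G Y)))
    (hcard : ∀ j < jstar, ∀ z ∈ Cell (K - j), ∀ b ∈ Bk j, ∀ Q ∈ records W j K (E j) b,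
      (((Old.filter fun Y => slot Y = ⟨j, z⟩ ∧ (G Y).root = b ∧ (G Y).events.erase (G Y).root = Q).card : ℕ) : ℝ) ≤ nB b * ∏ e ∈ Q, n e) :
    ∑ Y ∈ Old, x Y ≤ ρbar * Real.exp (-κ₁) * V * ((Λ * Real.exp (ηbar - κ₁)) ^ (K - jstar + 1) / (1 - Λ * Real.exp (ηbar - κ₁))) :=
  sum_stock_le_twoRate_of_componentPrices Old slot (fun Y => (G Y).root) (fun Y => (G Y).events.erase (G Y).root) x Cell hV hΛ hcell W step E Bk hE hκ
    (fun b => Real.exp (-(reserve b + Emg b))) nB (fun _ _ _ => (Real.exp_pos _).le) hnB hρbar (fun e => Real.exp (-Emg e)) n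
    (fun _ _ _ => (Real.exp_pos _).le) hn hηbar hr hj hold hmem hkind
    (fun Y hY => mem_records_of_labelling W (E (slot Y).1) (hwf Y hY) (hpend Y hY) (hroot Y hY) (hev Y hY))
    (fun Y hY => componentPrice_of_labelling B (hadm Y hY) (hwf Y hY) (hx Y hY)) hcard

end Labelled

/-! ## §2 At the dictionary: the printed shapes' banking, and ONE infrared threshold from the typed flow -/

section Dictionary

variable {X γ : Type*} [DecidableEq γ]

/-- ★★★ **THE STOCK BUDGET AT THE DICTIONARY UNDER THE PRINTED SHAPES' BANKING**: §1 at `ε = PEv` (step, kind, fatness), windows `W = dictW R n₁` (birth `fatWait d′ + R_s + 1`, renewal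
`R_s + 1`, merger `n₁ + R_s`), costs ∕ credits ∕ margins ∕ reserves ∕ extensions = `T4PrintedShapeBanking`'s printed shapes for constants `C`, admissibility = `Consistent C K R`, given
the `Banking` those shapes satisfy (hypothesis `B` — supplied by `T4PrintedShapeBanking.banking_printedShape_of_flow` ∕ `exists_irThreshold`): `ρ_b = n_b·e^{−(reserve C g b + Emarg C b)}`
(`e^{−(2p₀(g_j) + Eb + μ(d′+1))}` at a birth of class `d′` at step `j`), `η_e = n_e·e^{−Emarg C e}` (`n_e·e^{−E₀}` at renewals and mergers), rate `κ₁ = C.κ₁`. [bookkeeping] -/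
theorem sum_stock_le_twoRate_of_printedShapeBanking (C : T4PrintedShapeBanking.Consts) {K : ℕ} {R : ℕ → ℕ} {g : ℕ → ℝ}
    (B : Banking (Consistent C K R) (dictW R C.n₁) (T4PrintedShapeBanking.cost C K R) (T4PrintedShapeBanking.credit C g)
      (fun e => C.κ₁ * ((dictW R C.n₁ e : ℕ) : ℝ) + T4PrintedShapeBanking.Emarg C e) (T4PrintedShapeBanking.reserve C g) (T4PrintedShapeBanking.extn C K R))
    (hκ : 0 ≤ C.κ₁) (Old : Finset X) (slot : X → (Σ _ : ℕ, γ)) (G : X → Gen PEv) (x : X → ℝ)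
    (Cell : ℕ → Finset γ) {V Λ : ℝ} (hV : 0 ≤ V) (hΛ : 0 ≤ Λ) (hcell : ∀ a, ((Cell a).card : ℝ) ≤ V * Λ ^ a)
    (step : PEv → ℕ) (E Bk : ℕ → Finset PEv) (hE : ∀ j, ∀ e ∈ E j, step e ∈ Ioc j K) {ρbar ηbar : ℝ}
    (nB n : PEv → ℝ) (hnB : ∀ j, ∀ b ∈ Bk j, 0 ≤ nB b) (hn : ∀ j, ∀ e ∈ E j, 0 ≤ n e)
    (hρbar : ∀ j, ∑ b ∈ Bk j, nB b * Real.exp (-(T4PrintedShapeBanking.reserve C g b + T4PrintedShapeBanking.Emarg C b)) ≤ ρbar)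
    (hηbar : ∀ j, ∀ τ ∈ Ioc j K, ∑ e ∈ E j with step e = τ, n e * Real.exp (-T4PrintedShapeBanking.Emarg C e) ≤ ηbar) (hr : Λ * Real.exp (ηbar - C.κ₁) < 1)
    {jstar : ℕ} (hj : jstar ≤ K) (hold : ∀ Y ∈ Old, (slot Y).1 < jstar) (hmem : ∀ Y ∈ Old, (slot Y).2 ∈ Cell (K - (slot Y).1))
    (hadm : ∀ Y ∈ Old, Consistent C K R (G Y)) (hwf : ∀ Y ∈ Old, (G Y).WF (dictW R C.n₁)) (hpend : ∀ Y ∈ Old, K < (G Y).reach (dictW R C.n₁))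
    (hroot : ∀ Y ∈ Old, (G Y).rootStep = (slot Y).1) (hkind : ∀ Y ∈ Old, (G Y).root ∈ Bk (slot Y).1)
    (hev : ∀ Y ∈ Old, (G Y).events.erase (G Y).root ⊆ E (slot Y).1)
    (hx : ∀ Y ∈ Old, x Y ≤ Real.exp (-credits (T4PrintedShapeBanking.credit C g) (G Y)) * Real.exp (lifeCost (dictW R C.n₁) (T4PrintedShapeBanking.cost C K R) (G Y)))
    (hcard : ∀ j < jstar, ∀ z ∈ Cell (K - j), ∀ b ∈ Bk j, ∀ Q ∈ records (dictW R C.n₁) j K (E j) b,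
      (((Old.filter fun Y => slot Y = ⟨j, z⟩ ∧ (G Y).root = b ∧ (G Y).events.erase (G Y).root = Q).card : ℕ) : ℝ) ≤ nB b * ∏ e ∈ Q, n e) :
    ∑ Y ∈ Old, x Y ≤ ρbar * Real.exp (-C.κ₁) * V * ((Λ * Real.exp (ηbar - C.κ₁)) ^ (K - jstar + 1) / (1 - Λ * Real.exp (ηbar - C.κ₁))) :=
  sum_stock_le_twoRate_of_bankedGenealogies Old slot G x Cell hV hΛ hcell (dictW R C.n₁) step E Bk hE hκ B nB n hnB hn hρbar hηbar hr hj hold hmem hadm hwf hpend hroot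
    hkind hev hx hcard

/-- ★★★ **ONE INFRARED THRESHOLD FOR EVERY CUTOFF, RUN AND LABELLED STOCK** (`T4PrintedShapeBanking.exists_irThreshold` ∘ §2): for valid symbolic constants with `a, A₀ > 0`, `L ≥ 1`,
`β₀ ≥ 0`, `r(q′+1) < p₀` there is ONE number `x₀` (constants only) such that along EVERY run `(g_s, R_s)_{s ≤ K}` obeying the typed (2.7) `B14.FlowIneq27`, (2.9) `B14FlowStep.FlowIneq29`
and (2.5) `B14.IsRj`, with `1 ≤ log g_s⁻²` and the infrared smallness `x₀ ≤ log g_K⁻²`, EVERY stock at the cutoff `K` labelled by consistent well-formed pending genealogies of the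
dictionary (data as in §2) obeys the road-[e] two-rate budget.  The banking of road [e] from the TYPED FLOW — (R1) is no longer a hypothesis. [bookkeeping] -/
theorem exists_irThreshold_stockBudget (C : T4PrintedShapeBanking.Consts) (hC : C.Valid) (ha : 0 < C.a) (hA : 0 < C.A₀) {L r : ℕ} (hL : 1 ≤ L) {β₀ : ℝ} (hβ : 0 ≤ β₀)
    (hrq : r * (C.q' + 1) < C.p₀) :
    ∃ x₀ : ℝ, ∀ (K : ℕ) (R : ℕ → ℕ) (g : ℕ → ℝ) (β' : ℝ),
      B14.FlowIneq27 g β' β₀ C.p₀ K → B14FlowStep.FlowIneq29 R g L β' β₀ K →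
      (∀ s, s ≤ K → B14.IsRj L r (g s) (R s)) → (∀ s, s ≤ K → 1 ≤ Real.log ((g s) ^ 2)⁻¹) → x₀ ≤ Real.log ((g K) ^ 2)⁻¹ →
      ∀ (Old : Finset X) (slot : X → (Σ _ : ℕ, γ)) (G : X → Gen PEv) (x : X → ℝ) (Cell : ℕ → Finset γ) (V Λ : ℝ),
        0 ≤ V → 0 ≤ Λ → (∀ a, ((Cell a).card : ℝ) ≤ V * Λ ^ a) →
      ∀ (step : PEv → ℕ) (E Bk : ℕ → Finset PEv), (∀ j, ∀ e ∈ E j, step e ∈ Ioc j K) →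
      ∀ (ρbar ηbar : ℝ) (nB n : PEv → ℝ), (∀ j, ∀ b ∈ Bk j, 0 ≤ nB b) → (∀ j, ∀ e ∈ E j, 0 ≤ n e) →
        (∀ j, ∑ b ∈ Bk j, nB b * Real.exp (-(T4PrintedShapeBanking.reserve C g b + T4PrintedShapeBanking.Emarg C b)) ≤ ρbar) →
        (∀ j, ∀ τ ∈ Ioc j K, ∑ e ∈ E j with step e = τ, n e * Real.exp (-T4PrintedShapeBanking.Emarg C e) ≤ ηbar) → Λ * Real.exp (ηbar - C.κ₁) < 1 →
      ∀ (jstar : ℕ), jstar ≤ K → (∀ Y ∈ Old, (slot Y).1 < jstar) → (∀ Y ∈ Old, (slot Y).2 ∈ Cell (K - (slot Y).1)) →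
        (∀ Y ∈ Old, Consistent C K R (G Y)) → (∀ Y ∈ Old, (G Y).WF (dictW R C.n₁)) → (∀ Y ∈ Old, K < (G Y).reach (dictW R C.n₁)) →
        (∀ Y ∈ Old, (G Y).rootStep = (slot Y).1) → (∀ Y ∈ Old, (G Y).root ∈ Bk (slot Y).1) →
        (∀ Y ∈ Old, (G Y).events.erase (G Y).root ⊆ E (slot Y).1) →
        (∀ Y ∈ Old, x Y ≤ Real.exp (-credits (T4PrintedShapeBanking.credit C g) (G Y)) * Real.exp (lifeCost (dictW R C.n₁) (T4PrintedShapeBanking.cost C K R) (G Y))) →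
        (∀ j < jstar, ∀ z ∈ Cell (K - j), ∀ b ∈ Bk j, ∀ Q ∈ records (dictW R C.n₁) j K (E j) b,
          (((Old.filter fun Y => slot Y = ⟨j, z⟩ ∧ (G Y).root = b ∧ (G Y).events.erase (G Y).root = Q).card : ℕ) : ℝ) ≤ nB b * ∏ e ∈ Q, n e) →
      ∑ Y ∈ Old, x Y ≤ ρbar * Real.exp (-C.κ₁) * V * ((Λ * Real.exp (ηbar - C.κ₁)) ^ (K - jstar + 1) / (1 - Λ * Real.exp (ηbar - C.κ₁))) := by
  obtain ⟨x₀, hx₀⟩ := exists_irThreshold C hC ha hA hL hβ hrq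
  refine ⟨x₀, ?_⟩
  intro K R g β' h27 h29 hR hx1 hxK Old slot G x Cell V Λ hV hΛ hcell step E Bk hE ρbar ηbar nB n hnB hn hρbar hηbar hr jstar hj hold hmem hadm hwf hpend hroot hkind hev hx hcard
  exact sum_stock_le_twoRate_of_printedShapeBanking C (hx₀ K R g β' h27 h29 hR hx1 hxK) hC.κ₁_nonneg Old slot G x Cell hV hΛ hcell step E Bk hE nB n hnB hn hρbar hηbar hr hj
    hold hmem hadm hwf hpend hroot hkind hev hx hcard

end Dictionary

/-! ## §3 The socket: the bad class weighs at most `1 − e^{−S_K}` of the total, `S_K` from the banked genealogies -/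

section Socket

variable {P : Params} {Gg : Type*} [GaugeGroup Gg] [MeasurableSpace Gg] [HaarData Gg] {j : ℕ}
variable {ι : Type*} [Fintype ι] [DecidableEq ι]
variable {X γ ε : Type*} [DecidableEq X] [DecidableEq γ] [DecidableEq ε]

/-- ★★★ **THE FINAL-LEVEL SOCKET OF ROAD [e] WITH ITS SMALLNESS DISCHARGED BY THE BANKED GENEALOGIES** (p771116's `sum_integral_le_weightKP_mul_sum_of_fibreDom` ∘ §1): per-history
fibrewise letters on the bad set with GOOD images (a), removal fibres injecting into the non-empty sub-families of a stock `Old σ` with multiplicative majorants (b), and — per image `σ` —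
the stock filed under birth slots and LABELLED by admissible well-formed pending genealogies priced below their raw factors under a `Banking` with banks `κ₁·W + E`, multiplicities and
residual budgets as in §1 ⇒ `Σ_{s ∈ B} ∫ t_s ≤ (1 − e^{−S_K})·Σ_s ∫ t_s` with `S_K = ρ̄e^{−κ₁}·V·(Λσ)^{K − j⋆ + 1}∕(1 − Λσ)`.  The per-run clause of `RelWeightBound` at one `(K, t)` on
the tower-free road, every analytic input displayed and the banking BY NAME. [bookkeeping] -/
theorem sum_integral_le_weightKP_mul_sum_of_bankedGenealogies {iP : DecidableEq (PBond P j)} (t : ι → Density P j Gg)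
    (fib : ι → Finset (PBond P j)) (Bad : Finset ι) (rm : ι → ι) (z : ι → ℝ)
    (hm : ∀ s, Measurable (t s)) (h0 : ∀ s V, 0 ≤ t s V) (hint : ∀ s, Integrable (t s) (fieldMeasure P j Gg))
    (hDom : ∀ s ∈ Bad, ∀ V, fibreIntegral (fib s) (t s) V ≤ z s * fibreIntegral (fib s) (t (rm s)) V)
    (hgood : ∀ s ∈ Bad, rm s ∉ Bad)
    (Old : ι → Finset X) (φ : ι → ι → Finset X) (x : X → ℝ) (hx0 : ∀ σ, ∀ Y ∈ Old σ, 0 ≤ x Y)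
    (hφ : ∀ σ, ∀ s ∈ Bad.filter (fun s => rm s = σ), φ σ s ⊆ Old σ ∧ (φ σ s).Nonempty) (hinj : ∀ σ, Set.InjOn (φ σ) (Bad.filter (fun s => rm s = σ)))
    (hz : ∀ σ, ∀ s ∈ Bad.filter (fun s => rm s = σ), z s ≤ ∏ Y ∈ φ σ s, x Y)
    (slot : ι → X → (Σ _ : ℕ, γ)) (G : ι → X → Gen ε)
    (Cell : ℕ → Finset γ) {V Λ : ℝ} (hV : 0 ≤ V) (hΛ : 0 ≤ Λ) (hcell : ∀ a, ((Cell a).card : ℝ) ≤ V * Λ ^ a)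
    (W : ε → ℕ) (step : ε → ℕ) {K : ℕ} (E Bk : ι → ℕ → Finset ε) (hE : ∀ σ j, ∀ e ∈ E σ j, step e ∈ Ioc j K) {κ₁ ρbar ηbar : ℝ} (hκ : 0 ≤ κ₁)
    {adm : Gen ε → Prop} {cost : Gen ε → ℕ → ℝ} {credit Emg reserve : ε → ℝ} {ext : Gen ε → Gen ε → ε → ℝ}
    (B : Banking adm W cost credit (fun e => κ₁ * (W e : ℝ) + Emg e) reserve ext)
    (nB n : ε → ℝ) (hnB : ∀ σ j, ∀ b ∈ Bk σ j, 0 ≤ nB b) (hn : ∀ σ j, ∀ e ∈ E σ j, 0 ≤ n e)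
    (hρbar : ∀ σ j, ∑ b ∈ Bk σ j, nB b * Real.exp (-(reserve b + Emg b)) ≤ ρbar)
    (hηbar : ∀ σ j, ∀ τ ∈ Ioc j K, ∑ e ∈ E σ j with step e = τ, n e * Real.exp (-Emg e) ≤ ηbar) (hr : Λ * Real.exp (ηbar - κ₁) < 1)
    {jstar : ℕ} (hj : jstar ≤ K) (hold : ∀ σ, ∀ Y ∈ Old σ, (slot σ Y).1 < jstar) (hmem : ∀ σ, ∀ Y ∈ Old σ, (slot σ Y).2 ∈ Cell (K - (slot σ Y).1))
    (hadm : ∀ σ, ∀ Y ∈ Old σ, adm (G σ Y)) (hwf : ∀ σ, ∀ Y ∈ Old σ, (G σ Y).WF W) (hpend : ∀ σ, ∀ Y ∈ Old σ, K < (G σ Y).reach W)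
    (hroot : ∀ σ, ∀ Y ∈ Old σ, (G σ Y).rootStep = (slot σ Y).1) (hkind : ∀ σ, ∀ Y ∈ Old σ, (G σ Y).root ∈ Bk σ (slot σ Y).1)
    (hev : ∀ σ, ∀ Y ∈ Old σ, (G σ Y).events.erase (G σ Y).root ⊆ E σ (slot σ Y).1)
    (hx : ∀ σ, ∀ Y ∈ Old σ, x Y ≤ Real.exp (-credits credit (G σ Y)) * Real.exp (lifeCost W cost (G σ Y)))
    (hcard : ∀ σ, ∀ j < jstar, ∀ zc ∈ Cell (K - j), ∀ b ∈ Bk σ j, ∀ Q ∈ records W j K (E σ j) b,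
      ((((Old σ).filter fun Y => slot σ Y = ⟨j, zc⟩ ∧ (G σ Y).root = b ∧ (G σ Y).events.erase (G σ Y).root = Q).card : ℕ) : ℝ) ≤ nB b * ∏ e ∈ Q, n e) :
    ∑ s ∈ Bad, ∫ V, t s V ∂fieldMeasure P j Gg ≤
      (1 - Real.exp (-(ρbar * Real.exp (-κ₁) * V * ((Λ * Real.exp (ηbar - κ₁)) ^ (K - jstar + 1) / (1 - Λ * Real.exp (ηbar - κ₁)))))) *
        ∑ s, ∫ V, t s V ∂fieldMeasure P j Gg :=
  sum_integral_le_weightKP_mul_sum_of_fibreDom t fib Bad rm z hm h0 hint hDom hgood Old φ x hx0 hφ hinj hz fun σ =>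
    sum_stock_le_twoRate_of_bankedGenealogies (Old σ) (slot σ) (G σ) x Cell hV hΛ hcell W step (E σ) (Bk σ) (hE σ) hκ B nB n (hnB σ) (hn σ) (hρbar σ) (hηbar σ) hr hj
      (hold σ) (hmem σ) (hadm σ) (hwf σ) (hpend σ) (hroot σ) (hkind σ) (hev σ) (hx σ) (hcard σ)

end Socket

/-! ## §4 (v1.1) The socket with the activities INSTANTIATED by the genealogies' raw factors: no labelling clause left -/

section Instantiated

variable {P : Params} {Gg : Type*} [GaugeGroup Gg] [MeasurableSpace Gg] [HaarData Gg] {j : ℕ}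
variable {ι : Type*} [Fintype ι] [DecidableEq ι]
variable {X γ ε : Type*} [DecidableEq X] [DecidableEq γ] [DecidableEq ε]

/-- ★★★ **THE SOCKET WITH THE ACTIVITIES INSTANTIATED** (§3 with `x Y := e^{−credits(G Y)}·e^{+lifeCost(G Y)}`, each candidate `Y : X` CARRYING its genealogy `G Y` — the labelling
clause `hx` holds with equality and `hx0` by positivity, so both vanish): per-history fibrewise letters on the bad set with good images whose factors are dominated by the PRODUCT OF THE
RAW FACTORS of the removed components' genealogies, `z s ≤ Π_{Y ∈ φ σ s} e^{−credits(G Y)}·e^{+lifeCost(G Y)}` ((a) READ on the genealogy ledger — the one remaining analytic letter),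
removal fibres injecting into the non-empty sub-families of the stocks `Old σ` ((b)), stocks filed under old birth slots by admissible well-formed pending genealogies rooted there with
root kinds in `Bk σ j` and records inside `E σ j`, multiplicities and residual budgets ((ID)), cells, and a `Banking` with banks `κ₁·W + E` ((B), §2) ⇒
`Σ_{s ∈ B} ∫ t_s ≤ (1 − e^{−S_K})·Σ_s ∫ t_s`, `S_K = ρ̄e^{−κ₁}·V·(Λσ)^{K − j⋆ + 1}∕(1 − Λσ)`. [bookkeeping] -/
theorem sum_integral_le_weightKP_mul_sum_of_genealogyFactors {iP : DecidableEq (PBond P j)} (t : ι → Density P j Gg)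
    (fib : ι → Finset (PBond P j)) (Bad : Finset ι) (rm : ι → ι) (z : ι → ℝ)
    (hm : ∀ s, Measurable (t s)) (h0 : ∀ s V, 0 ≤ t s V) (hint : ∀ s, Integrable (t s) (fieldMeasure P j Gg))
    (hDom : ∀ s ∈ Bad, ∀ V, fibreIntegral (fib s) (t s) V ≤ z s * fibreIntegral (fib s) (t (rm s)) V)
    (hgood : ∀ s ∈ Bad, rm s ∉ Bad)
    {adm : Gen ε → Prop} {W : ε → ℕ} {cost : Gen ε → ℕ → ℝ} {credit Emg reserve : ε → ℝ} {ext : Gen ε → Gen ε → ε → ℝ} {κ₁ : ℝ} (hκ : 0 ≤ κ₁)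
    (B : Banking adm W cost credit (fun e => κ₁ * (W e : ℝ) + Emg e) reserve ext) (G : X → Gen ε)
    (Old : ι → Finset X) (φ : ι → ι → Finset X)
    (hφ : ∀ σ, ∀ s ∈ Bad.filter (fun s => rm s = σ), φ σ s ⊆ Old σ ∧ (φ σ s).Nonempty) (hinj : ∀ σ, Set.InjOn (φ σ) (Bad.filter (fun s => rm s = σ)))
    (hz : ∀ σ, ∀ s ∈ Bad.filter (fun s => rm s = σ), z s ≤ ∏ Y ∈ φ σ s, Real.exp (-credits credit (G Y)) * Real.exp (lifeCost W cost (G Y)))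
    (slot : X → (Σ _ : ℕ, γ)) (Cell : ℕ → Finset γ) {V Λ : ℝ} (hV : 0 ≤ V) (hΛ : 0 ≤ Λ) (hcell : ∀ a, ((Cell a).card : ℝ) ≤ V * Λ ^ a)
    (step : ε → ℕ) {K : ℕ} (E Bk : ι → ℕ → Finset ε) (hE : ∀ σ j, ∀ e ∈ E σ j, step e ∈ Ioc j K) {ρbar ηbar : ℝ}
    (nB n : ε → ℝ) (hnB : ∀ σ j, ∀ b ∈ Bk σ j, 0 ≤ nB b) (hn : ∀ σ j, ∀ e ∈ E σ j, 0 ≤ n e)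
    (hρbar : ∀ σ j, ∑ b ∈ Bk σ j, nB b * Real.exp (-(reserve b + Emg b)) ≤ ρbar)
    (hηbar : ∀ σ j, ∀ τ ∈ Ioc j K, ∑ e ∈ E σ j with step e = τ, n e * Real.exp (-Emg e) ≤ ηbar) (hr : Λ * Real.exp (ηbar - κ₁) < 1)
    {jstar : ℕ} (hj : jstar ≤ K) (hold : ∀ σ, ∀ Y ∈ Old σ, (slot Y).1 < jstar) (hmem : ∀ σ, ∀ Y ∈ Old σ, (slot Y).2 ∈ Cell (K - (slot Y).1))
    (hadm : ∀ σ, ∀ Y ∈ Old σ, adm (G Y)) (hwf : ∀ σ, ∀ Y ∈ Old σ, (G Y).WF W) (hpend : ∀ σ, ∀ Y ∈ Old σ, K < (G Y).reach W)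
    (hroot : ∀ σ, ∀ Y ∈ Old σ, (G Y).rootStep = (slot Y).1) (hkind : ∀ σ, ∀ Y ∈ Old σ, (G Y).root ∈ Bk σ (slot Y).1)
    (hev : ∀ σ, ∀ Y ∈ Old σ, (G Y).events.erase (G Y).root ⊆ E σ (slot Y).1)
    (hcard : ∀ σ, ∀ j < jstar, ∀ zc ∈ Cell (K - j), ∀ b ∈ Bk σ j, ∀ Q ∈ records W j K (E σ j) b,
      ((((Old σ).filter fun Y => slot Y = ⟨j, zc⟩ ∧ (G Y).root = b ∧ (G Y).events.erase (G Y).root = Q).card : ℕ) : ℝ) ≤ nB b * ∏ e ∈ Q, n e) :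
    ∑ s ∈ Bad, ∫ V, t s V ∂fieldMeasure P j Gg ≤
      (1 - Real.exp (-(ρbar * Real.exp (-κ₁) * V * ((Λ * Real.exp (ηbar - κ₁)) ^ (K - jstar + 1) / (1 - Λ * Real.exp (ηbar - κ₁)))))) *
        ∑ s, ∫ V, t s V ∂fieldMeasure P j Gg :=
  sum_integral_le_weightKP_mul_sum_of_bankedGenealogies t fib Bad rm z hm h0 hint hDom hgood Old φ
    (fun Y => Real.exp (-credits credit (G Y)) * Real.exp (lifeCost W cost (G Y))) (fun _ _ _ => (mul_pos (Real.exp_pos _) (Real.exp_pos _)).le) hφ hinj hz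
    (fun _ => slot) (fun _ => G) Cell hV hΛ hcell W step E Bk hE hκ B nB n hnB hn hρbar hηbar hr hj hold hmem hadm hwf hpend hroot hkind hev (fun _ _ _ => le_rfl) hcard

end Instantiated

end YMDAG.UVSplit
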